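import Mathlib
import Summits.MatrixMultiplication.MatrixMultiplication.Theorems.FourierTwoFamiliesModPPrimeCyclicPowerGainThetaPrelim
import Summits.MatrixMultiplication.MatrixMultiplication.Theorems.FourierTwoFamiliesModPPrimeCyclicPowerGainThetaHalfDensity
import Summits.MatrixMultiplication.MatrixMultiplication.Theorems.FourierTwoFamiliesModPPrimeCyclicPowerGainThetaConvolution

/-!
# The degree-one (scalar Delsarte) certificate bound for theta-body kernels

Crux `stmt-MatrixMultiplication-14310` (`FourierTwoFamiliesModP.PrimeLogDecay`), line
`fixed-delta-theta-certificate`; closes the registered stub `stub_thetaDegreeOne`, the master degree-one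
lemma of the line (it closes the "uniform branch" of the composition `PrimeLogDecay_of`).

Setting (shared with the imported sibling files `…ThetaPrelim`, `…ThetaHalfDensity`, `…ThetaConvolution`):
`G` a finite additive commutative group, vertices `v = (v.1, v.2) ∈ Finset G × Finset G` ("blocks"), a kernel
`B` that is symmetric, PSD as a real quadratic form, ENTRYWISE NONNEGATIVE, of trace `1`, supported on pairs
of admissible vertices (`|v.1| = |v.2| = s`, clause (W), `v.1 − v.2 ⊆ X₀`) that are equal or compatible
(cross differences avoid `X₀`); `X = Σ_{v,w} B v w`, `N = |G|`.  A real test function `F ≤ 1` on `X₀`, `≤ 0`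
off `X₀`, whose NONTRIVIAL character sums have norm `≤ M` (`M ≥ 0`), certifies
`s · X · Σ F ≤ s · N + M · (N − s · X)` (`stub_thetaDegreeOne`).

Proof.  `rep v w x = #{(a,b) ∈ v.1 × w.2 : a − b = x}`, `FB x = Σ_{v,w} B v w · rep v w x`, `Φ = Σ_x F x · FB x`.
(`sum_F_mul_le`) `Φ ≤ s²`: diagonal terms represent `x ∈ v.1 − v.2 ⊆ X₀` (`F ≤ 1`; total mass `s²` by
`HalfDensity.sum_delta`), off-diagonal support terms are compatible pairs representing `x ∉ X₀` (`F ≤ 0`,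
`B ≥ 0`, `rep ≥ 0`).  (`sum_F_mul_ge`) `Φ ≥ (ΣF) s²X/N − M (s − s²X/N)`: the mean/fluctuation split of
`HalfDensity.F_lower` (`FB_split`) gives `Φ = (ΣF) s²X/N + S`, `S = Σ_y Σ_{v,w} f̃_v(y) B_vw (F ∗ g̃_w)(y)`, and
`F ∗ g̃_w = θ ∗ g̃_w` for the mean-zero `θ = F − (ΣF)/N`, all of whose character sums are `≤ M`
(`AddChar.sum_eq_zero_of_ne_one`).  Square-root-free Cauchy–Schwarz (`cross_sq_le`: PSD polarisation
`Kernel.neg_add_le_two_mul_cross_of_psd` plus the discriminant) gives `S² ≤ P_A · Q` with `P_A = s − s²X/N`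
(`Fluct.fluctA_energy`) and `Q ≤ M² P_B = M² (s − s²X/N)` (`Convolution.conv_energy_le`, `Fluct.fluctB_energy`),
so `S ≥ −M (s − s²X/N)`.  Assembly: multiply `(ΣF) s²X/N − M (s − s²X/N) ≤ Φ ≤ s²` by `N/s`.
-/

namespace Summit.MatrixMultiplication.MatrixMultiplication.Theorems.PrimeLogDecayTheta.DegreeOne

open scoped BigOperators Pointwise ComplexConjugate
open Summit.MatrixMultiplication.MatrixMultiplication.Theorems.PrimeCyclicPowerGainTheta

/-! ### Generic kernel facts: summation order and Cauchy–Schwarz -/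

section Generic

variable {V Y : Type*} [Fintype V] [Fintype Y]

/-- Reordering: `Σ_y Σ_{v,w} u_v(y) B_vw u'_w(y) = Σ_{v,w} B_vw Σ_y u_v(y) u'_w(y)`. -/
theorem triple_sum_comm (B : V → V → ℝ) (u u' : V → Y → ℝ) :
    ∑ y, ∑ v, ∑ w, u v y * B v w * u' w y = ∑ v, ∑ w, B v w * ∑ y, u v y * u' w y := by
  rw [Finset.sum_comm]; refine Finset.sum_congr rfl fun v _ => ?_
  rw [Finset.sum_comm]; refine Finset.sum_congr rfl fun w _ => ?_
  rw [Finset.mul_sum]; exact Finset.sum_congr rfl fun y _ => by ring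

/-- Pulling a scalar out of the first slot: `Σ_{v,w} (t u_v) B_vw x_w = t · Σ_{v,w} u_v B_vw x_w`. -/
theorem smul_cross (B : V → V → ℝ) (u x : V → ℝ) (t : ℝ) :
    ∑ v, ∑ w, t * u v * B v w * x w = t * ∑ v, ∑ w, u v * B v w * x w := by
  rw [Finset.mul_sum]; refine Finset.sum_congr rfl fun v _ => ?_
  rw [Finset.mul_sum]; exact Finset.sum_congr rfl fun w _ => by ring

/-- **Square-root-free Cauchy–Schwarz** for the semi-inner product `Σ_y Σ_{v,w} u_v(y) B_vw h_w(y)` of a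
symmetric PSD kernel: `S² ≤ P · Q` (discriminant of the nonnegative quadratic `t ↦ Σ_y (t u + h)ᵀ B (t u + h)`). -/
theorem cross_sq_le (B : V → V → ℝ) (hsymm : ∀ v w, B v w = B w v)
    (hpsd : ∀ x : V → ℝ, 0 ≤ ∑ v, ∑ w, x v * B v w * x w) (u h : V → Y → ℝ) :
    (∑ y, ∑ v, ∑ w, u v y * B v w * h w y) ^ 2 ≤
      (∑ y, ∑ v, ∑ w, u v y * B v w * u w y) * (∑ y, ∑ v, ∑ w, h v y * B v w * h w y) := by
  have hq : ∀ t : ℝ, 0 ≤ (∑ y, ∑ v, ∑ w, u v y * B v w * u w y) * (t * t) +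
      2 * (∑ y, ∑ v, ∑ w, u v y * B v w * h w y) * t + ∑ y, ∑ v, ∑ w, h v y * B v w * h w y := by
    intro t
    have hy : ∀ y : Y, 0 ≤ t * t * (∑ v, ∑ w, u v y * B v w * u w y) +
        2 * t * (∑ v, ∑ w, u v y * B v w * h w y) + ∑ v, ∑ w, h v y * B v w * h w y := by
      intro y
      have h0 : -(∑ v, ∑ w, t * u v y * B v w * (t * u w y) + ∑ v, ∑ w, h v y * B v w * h w y) ≤
          2 * ∑ v, ∑ w, t * u v y * B v w * h w y :=
        Kernel.neg_add_le_two_mul_cross_of_psd B hsymm hpsd (fun v => t * u v y) (fun w => h w y)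
      have e1 : ∑ v, ∑ w, t * u v y * B v w * (t * u w y) = t * t * ∑ v, ∑ w, u v y * B v w * u w y := by
        rw [smul_cross B (fun v => u v y) (fun w => t * u w y) t,
          Kernel.cross_comm B hsymm (fun v => u v y) (fun w => t * u w y),
          smul_cross B (fun w => u w y) (fun v => u v y) t, mul_assoc,
          Kernel.cross_comm B hsymm (fun w => u w y) (fun v => u v y)]
      rw [e1, smul_cross B (fun v => u v y) (fun w => h w y) t] at h0
      linarith
    have hs := Finset.sum_nonneg fun y (_ : y ∈ (Finset.univ : Finset Y)) => hy y
    simp only [Finset.sum_add_distrib, ← Finset.mul_sum] at hs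
    linarith
  have hd := discrim_le_zero hq; rw [discrim] at hd; nlinarith [hd]

end Generic

/-! ### Facts on the group side: the centred test function -/

section Group

variable {G : Type*} [AddCommGroup G] [Fintype G]

/-- Swapping sums: `Σ_x F x · Σ_y Σ_{v,w} f_v(y) B_vw g_w(y − x) = Σ_y Σ_{v,w} f_v(y) B_vw · Σ_x F x g_w(y − x)`. -/
theorem sum_mul_conv_swap {V : Type*} [Fintype V] (B : V → V → ℝ) (f g : V → G → ℝ) (F : G → ℝ) :
    ∑ x, F x * ∑ y, ∑ v, ∑ w, f v y * B v w * g w (y - x) =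
      ∑ y, ∑ v, ∑ w, f v y * B v w * ∑ x, F x * g w (y - x) := by
  simp_rw [Finset.mul_sum]
  rw [Finset.sum_comm]
  refine Finset.sum_congr rfl fun y _ => ?_
  rw [Finset.sum_comm]
  refine Finset.sum_congr rfl fun v _ => ?_
  rw [Finset.sum_comm]
  exact Finset.sum_congr rfl fun w _ => Finset.sum_congr rfl fun x _ => by ring

/-- Convolution with the centred `F − (ΣF)/|G|` agrees with convolution with `F` against a mean-zero `g`. -/
theorem conv_centred_eq (F g : G → ℝ) (hg : ∑ z, g z = 0) (y : G) :
    ∑ x, (F x - (∑ z, F z) / (Fintype.card G : ℝ)) * g (y - x) = ∑ x, F x * g (y - x) := by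
  have hre : ∑ x, g (y - x) = ∑ z, g z := Fintype.sum_equiv (Equiv.subLeft y) _ _ fun _ => rfl
  simp only [sub_mul]
  rw [Finset.sum_sub_distrib, ← Finset.mul_sum, hre, hg, mul_zero, sub_zero]

/-- All character sums of the centred `θ = F − (ΣF)/|G|` are `≤ M` once the NONTRIVIAL character sums of
`F` are: `θ̂ = F̂` off the trivial character (`Σ_x ψ x = 0` for `ψ ≠ 1`), and `θ̂(1) = Σ θ = 0 ≤ M`. -/
theorem charsum_centred_le (F : G → ℝ) (M : ℝ) (hM : 0 ≤ M)
    (hFM : ∀ ψ : AddChar G ℂ, ψ ≠ 1 → ‖∑ x, (F x : ℂ) * ψ x‖ ≤ M) (ψ : AddChar G ℂ) :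
    ‖∑ x, ((F x - (∑ z, F z) / (Fintype.card G : ℝ) : ℝ) : ℂ) * ψ x‖ ≤ M := by
  have hN : (Fintype.card G : ℝ) ≠ 0 := by exact_mod_cast Fintype.card_ne_zero
  by_cases hψ : ψ = 1
  · subst hψ
    have hθ : ∑ x, (F x - (∑ z, F z) / (Fintype.card G : ℝ)) = 0 := by
      rw [Finset.sum_sub_distrib, Finset.sum_const, Finset.card_univ, nsmul_eq_mul,
        mul_div_cancel₀ _ hN, sub_self]
    have h0 : ∑ x, ((F x - (∑ z, F z) / (Fintype.card G : ℝ) : ℝ) : ℂ) * (1 : AddChar G ℂ) x = 0 := by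
      simp only [AddChar.one_apply, mul_one]
      rw [← Complex.ofReal_sum, hθ, Complex.ofReal_zero]
    rw [h0, norm_zero]; exact hM
  · have h1 : ∑ x, ((F x - (∑ z, F z) / (Fintype.card G : ℝ) : ℝ) : ℂ) * ψ x =
        ∑ x, (F x : ℂ) * ψ x := by
      have e : ∀ x, ((F x - (∑ z, F z) / (Fintype.card G : ℝ) : ℝ) : ℂ) * ψ x =
          (F x : ℂ) * ψ x - (((∑ z, F z) / (Fintype.card G : ℝ) : ℝ) : ℂ) * ψ x := by
        intro x; push_cast; ring
      rw [Finset.sum_congr rfl fun x _ => e x, Finset.sum_sub_distrib, ← Finset.mul_sum,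
        AddChar.sum_eq_zero_of_ne_one hψ, mul_zero, sub_zero]
    rw [h1]; exact hFM ψ hψ

/-- `Convolution.conv_energy_le` in the summation order of `Fluct`: convolution by `θ` (all character sums
`≤ M`) contracts the energy `Σ_y Σ_{v,w} h_v(y) B_vw h_w(y)` by `M²`. -/
theorem conv_energy_le' {V : Type*} [Fintype V] (B : V → V → ℝ) (h : V → G → ℝ) (θ : G → ℝ) (M : ℝ)
    (hpsd : ∀ x : V → ℝ, 0 ≤ ∑ v, ∑ w, x v * B v w * x w)
    (hM : ∀ ψ : AddChar G ℂ, ‖∑ x, (θ x : ℂ) * ψ x‖ ≤ M) :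
    ∑ y, ∑ v, ∑ w, (∑ x, θ x * h v (y - x)) * B v w * (∑ x, θ x * h w (y - x)) ≤
      M ^ 2 * ∑ y, ∑ v, ∑ w, h v y * B v w * h w y := by
  calc ∑ y, ∑ v, ∑ w, (∑ x, θ x * h v (y - x)) * B v w * (∑ x, θ x * h w (y - x))
      = ∑ v, ∑ w, B v w * ∑ y, (∑ x, θ x * h v (y - x)) * (∑ x, θ x * h w (y - x)) :=
        triple_sum_comm B (fun v y => ∑ x, θ x * h v (y - x)) (fun w y => ∑ x, θ x * h w (y - x))
    _ ≤ M ^ 2 * ∑ v, ∑ w, B v w * ∑ y, h v y * h w y := Convolution.conv_energy_le B h θ M hpsd hM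
    _ = M ^ 2 * ∑ y, ∑ v, ∑ w, h v y * B v w * h w y := by rw [triple_sum_comm B h h]

end Group

/-! ### The two bounds on `Φ = Σ_x F x · FB x` -/

section Bounds

variable {G : Type*} [AddCommGroup G] [Fintype G] [DecidableEq G]

/-- **Upper bound** `Σ_x F x · FB x ≤ s²`: diagonal terms live on `X₀` (`F ≤ 1`), off-diagonal support terms
are compatible pairs and live off `X₀` (`F ≤ 0`, `B ≥ 0` entrywise, `rep ≥ 0`). -/
theorem sum_F_mul_le (s : ℕ) (X₀ : Finset G) (B : Finset G × Finset G → Finset G × Finset G → ℝ)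
    (F : G → ℝ) (hnn : ∀ v w, 0 ≤ B v w)
    (hcard : ∀ v : Finset G × Finset G, B v v ≠ 0 → v.1.card = s ∧ v.2.card = s)
    (hD : ∀ v : Finset G × Finset G, B v v ≠ 0 → v.1 - v.2 ⊆ X₀)
    (hX : ∀ v w : Finset G × Finset G, B v w ≠ 0 → v ≠ w → Disjoint (v.1 - w.2) X₀)
    (htr : ∑ v, B v v = 1) (hF1 : ∀ x ∈ X₀, F x ≤ 1) (hF0 : ∀ x, x ∉ X₀ → F x ≤ 0) :
    ∑ x, F x * ∑ v, ∑ w, B v w * ∑ a ∈ v.1, ∑ b ∈ w.2, (if a - b = x then (1 : ℝ) else 0) ≤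
      (s : ℝ) ^ 2 := by
  have key : ∀ (x : G) (v : Finset G × Finset G),
      ∑ w, F x * (B v w * ∑ a ∈ v.1, ∑ b ∈ w.2, (if a - b = x then (1 : ℝ) else 0)) ≤
        B v v * ∑ a ∈ v.1, ∑ b ∈ v.2, (if a - b = x then (1 : ℝ) else 0) := by
    intro x v
    rw [← Finset.add_sum_erase Finset.univ _ (Finset.mem_univ v)]
    have hdiag : F x * (B v v * ∑ a ∈ v.1, ∑ b ∈ v.2, (if a - b = x then (1 : ℝ) else 0)) ≤
        B v v * ∑ a ∈ v.1, ∑ b ∈ v.2, (if a - b = x then (1 : ℝ) else 0) := by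
      by_cases hB : B v v = 0
      · rw [hB, zero_mul, mul_zero]
      · by_cases hr : ∑ a ∈ v.1, ∑ b ∈ v.2, (if a - b = x then (1 : ℝ) else 0) = 0
        · rw [hr, mul_zero, mul_zero]
        · exact mul_le_of_le_one_left (mul_nonneg (hnn v v) (Rep.rep_nonneg v v x))
            (hF1 x (hD v hB (Rep.mem_sub_of_rep_ne_zero v v x hr)))
    have hoff : ∑ w ∈ Finset.univ.erase v,
        F x * (B v w * ∑ a ∈ v.1, ∑ b ∈ w.2, (if a - b = x then (1 : ℝ) else 0)) ≤ 0 := by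
      refine Finset.sum_nonpos fun w hw => ?_
      by_cases hB : B v w = 0
      · rw [hB, zero_mul, mul_zero]
      · by_cases hr : ∑ a ∈ v.1, ∑ b ∈ w.2, (if a - b = x then (1 : ℝ) else 0) = 0
        · rw [hr, mul_zero, mul_zero]
        · have hx : x ∉ X₀ := Finset.disjoint_left.1 (hX v w hB (Finset.ne_of_mem_erase hw).symm)
            (Rep.mem_sub_of_rep_ne_zero v w x hr)
          exact mul_nonpos_of_nonpos_of_nonneg (hF0 x hx) (mul_nonneg (hnn v w) (Rep.rep_nonneg v w x))
    linarith
  calc ∑ x, F x * ∑ v, ∑ w, B v w * ∑ a ∈ v.1, ∑ b ∈ w.2, (if a - b = x then (1 : ℝ) else 0)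
      = ∑ x, ∑ v, ∑ w, F x * (B v w * ∑ a ∈ v.1, ∑ b ∈ w.2, (if a - b = x then (1 : ℝ) else 0)) := by
        refine Finset.sum_congr rfl fun x _ => ?_
        rw [Finset.mul_sum]
        exact Finset.sum_congr rfl fun v _ => Finset.mul_sum _ _ _
    _ ≤ ∑ x, ∑ v, B v v * ∑ a ∈ v.1, ∑ b ∈ v.2, (if a - b = x then (1 : ℝ) else 0) :=
        Finset.sum_le_sum fun x _ => Finset.sum_le_sum fun v _ => key x v
    _ = (s : ℝ) ^ 2 := HalfDensity.sum_delta s B hcard htr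

/-- **Mean/fluctuation split of `FB`** (the bookkeeping of `HalfDensity.F_lower`): on a support of balanced
blocks of size `s`, `FB x = s²X/N + Σ_y Σ_{v,w} (1_{v.1}(y) − |v.1|/N) B_vw (1_{w.2}(y − x) − |w.2|/N)`. -/
theorem FB_split (s : ℕ) (B : Finset G × Finset G → Finset G × Finset G → ℝ)
    (hc : ∀ v w : Finset G × Finset G, B v w ≠ 0 →
      v.1.card = s ∧ v.2.card = s ∧ w.1.card = s ∧ w.2.card = s) (x : G) :
    ∑ v, ∑ w, B v w * ∑ a ∈ v.1, ∑ b ∈ w.2, (if a - b = x then (1 : ℝ) else 0) =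
      (s : ℝ) ^ 2 * (∑ v, ∑ w, B v w) / (Fintype.card G : ℝ) +
      ∑ y, ∑ v, ∑ w, ((if y ∈ v.1 then (1 : ℝ) else 0) - (v.1.card : ℝ) / (Fintype.card G : ℝ)) *
        B v w * ((if y - x ∈ w.2 then (1 : ℝ) else 0) - (w.2.card : ℝ) / (Fintype.card G : ℝ)) := by
  have hN : (0 : ℝ) < Fintype.card G := by exact_mod_cast Fintype.card_pos
  set N : ℝ := (Fintype.card G : ℝ) with hNdef
  set X : ℝ := ∑ v, ∑ w, B v w with hXdef
  set fA : Finset G × Finset G → G → ℝ := fun v y => if y ∈ v.1 then 1 else 0 with hfA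
  set gB : Finset G × Finset G → G → ℝ := fun w z => if z ∈ w.2 then 1 else 0 with hgB
  set cA : Finset G × Finset G → ℝ := fun v => (v.1.card : ℝ) / N with hcA
  set cB : Finset G × Finset G → ℝ := fun w => (w.2.card : ℝ) / N with hcB
  set ft : Finset G × Finset G → G → ℝ := fun v y => fA v y - cA v with hft
  set gt : Finset G × Finset G → G → ℝ := fun w z => gB w z - cB w with hgt
  rw [Fluct.F_eq_sum B x]
  change ∑ y, ∑ v, ∑ w, fA v y * B v w * gB w (y - x) =
    (s : ℝ) ^ 2 * X / N + ∑ y, ∑ v, ∑ w, ft v y * B v w * gt w (y - x)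
  -- the four-term expansion
  have hsplit : ∑ y, ∑ v, ∑ w, fA v y * B v w * gB w (y - x) =
      ∑ _y : G, ∑ v, ∑ w, cA v * B v w * cB w + ∑ y, ∑ v, ∑ w, cA v * B v w * gt w (y - x)
      + ∑ y, ∑ v, ∑ w, ft v y * B v w * cB w + ∑ y, ∑ v, ∑ w, ft v y * B v w * gt w (y - x) := by
    simp only [← Finset.sum_add_distrib]
    refine Finset.sum_congr rfl fun y _ => Finset.sum_congr rfl fun v _ =>
      Finset.sum_congr rfl fun w _ => ?_
    simp only [hft, hgt]; ring
  -- T1 = s² X / N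
  have hT1 : ∑ _y : G, ∑ v, ∑ w, cA v * B v w * cB w = (s : ℝ) ^ 2 * X / N := by
    rw [Finset.sum_const, Finset.card_univ, nsmul_eq_mul]
    have : ∑ v, ∑ w, cA v * B v w * cB w = ∑ v, ∑ w, B v w * ((s : ℝ) ^ 2 / N ^ 2) := by
      refine Finset.sum_congr rfl fun v _ => Finset.sum_congr rfl fun w _ => ?_
      by_cases hB : B v w = 0
      · rw [hB]; ring
      · obtain ⟨h1, -, -, h4⟩ := hc v w hB
        simp only [hcA, hcB, h1, h4]; ring
    rw [this]; simp only [← Finset.sum_mul]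
    rw [← hXdef, ← hNdef]; field_simp
  -- T2 = 0
  have hT2 : ∑ y, ∑ v, ∑ w, cA v * B v w * gt w (y - x) = 0 := by
    rw [Finset.sum_comm]; refine Finset.sum_eq_zero fun v _ => ?_
    rw [Finset.sum_comm]; refine Finset.sum_eq_zero fun w _ => ?_
    rw [← Finset.mul_sum, Rep.sum_sub_arg (fun z => gt w z) x]
    have : ∑ z, gt w z = 0 := by simp only [hgt, hgB, hcB]; exact Rep.sum_fluct w.2
    rw [this, mul_zero]
  -- T3 = 0
  have hT3 : ∑ y, ∑ v, ∑ w, ft v y * B v w * cB w = 0 := by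
    rw [Finset.sum_comm]; refine Finset.sum_eq_zero fun v _ => ?_
    rw [Finset.sum_comm]; refine Finset.sum_eq_zero fun w _ => ?_
    have hre : ∀ y : G, ft v y * B v w * cB w = ft v y * (B v w * cB w) := fun y => by ring
    rw [Finset.sum_congr rfl fun y _ => hre y, ← Finset.sum_mul]
    have : ∑ y, ft v y = 0 := by simp only [hft, hfA, hcA]; exact Rep.sum_fluct v.1
    rw [this, zero_mul]
  rw [hsplit, hT1, hT2, hT3, add_zero, add_zero]

/-- **Lower bound** `Σ_x F x · FB x ≥ (ΣF) · s²X/N − M · (s − s²X/N)` for a symmetric PSD trace-one kernel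
supported on balanced blocks of size `s` with pairwise disjoint `A`-sides and pairwise disjoint `B`-sides, and a
test function `F` whose nontrivial character sums are `≤ M`. -/
theorem sum_F_mul_ge (s : ℕ) (B : Finset G × Finset G → Finset G × Finset G → ℝ) (F : G → ℝ) (M : ℝ)
    (hsymm : ∀ v w, B v w = B w v)
    (hpsd : ∀ x : Finset G × Finset G → ℝ, 0 ≤ ∑ v, ∑ w, x v * B v w * x w)
    (hc : ∀ v w : Finset G × Finset G, B v w ≠ 0 →
      v.1.card = s ∧ v.2.card = s ∧ w.1.card = s ∧ w.2.card = s)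
    (hdA : ∀ v w : Finset G × Finset G, B v w ≠ 0 → v ≠ w → Disjoint v.1 w.1)
    (hdB : ∀ v w : Finset G × Finset G, B v w ≠ 0 → v ≠ w → Disjoint v.2 w.2)
    (htr : ∑ v, B v v = 1) (hM : 0 ≤ M)
    (hFM : ∀ ψ : AddChar G ℂ, ψ ≠ 1 → ‖∑ x, (F x : ℂ) * ψ x‖ ≤ M) :
    (∑ x, F x) * ((s : ℝ) ^ 2 * (∑ v, ∑ w, B v w) / (Fintype.card G : ℝ)) -
        M * ((s : ℝ) - (s : ℝ) ^ 2 * (∑ v, ∑ w, B v w) / (Fintype.card G : ℝ)) ≤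
      ∑ x, F x * ∑ v, ∑ w, B v w * ∑ a ∈ v.1, ∑ b ∈ w.2, (if a - b = x then (1 : ℝ) else 0) := by
  have hN : (0 : ℝ) < Fintype.card G := by exact_mod_cast Fintype.card_pos
  set N : ℝ := (Fintype.card G : ℝ)
  set X : ℝ := ∑ v, ∑ w, B v w
  set ft : Finset G × Finset G → G → ℝ :=
    fun v y => (if y ∈ v.1 then (1 : ℝ) else 0) - (v.1.card : ℝ) / N
  set gt : Finset G × Finset G → G → ℝ :=
    fun w z => (if z ∈ w.2 then (1 : ℝ) else 0) - (w.2.card : ℝ) / N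
  set H : Finset G × Finset G → G → ℝ := fun w y => ∑ x, F x * gt w (y - x)
  set θ : G → ℝ := fun x => F x - (∑ z, F z) / N
  -- mean/fluctuation split and the swap: Φ = (ΣF) s²X/N + S
  have hFB : ∀ x : G, ∑ v, ∑ w, B v w * ∑ a ∈ v.1, ∑ b ∈ w.2, (if a - b = x then (1 : ℝ) else 0) =
      (s : ℝ) ^ 2 * X / N + ∑ y, ∑ v, ∑ w, ft v y * B v w * gt w (y - x) :=
    fun x => FB_split s B hc x
  have hswap : ∑ x, F x * ∑ y, ∑ v, ∑ w, ft v y * B v w * gt w (y - x) =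
      ∑ y, ∑ v, ∑ w, ft v y * B v w * H w y := sum_mul_conv_swap B ft gt F
  have hΦ : ∑ x, F x * ∑ v, ∑ w, B v w * ∑ a ∈ v.1, ∑ b ∈ w.2, (if a - b = x then (1 : ℝ) else 0) =
      (∑ x, F x) * ((s : ℝ) ^ 2 * X / N) + ∑ y, ∑ v, ∑ w, ft v y * B v w * H w y := by
    rw [← hswap, Finset.sum_mul, ← Finset.sum_add_distrib]
    refine Finset.sum_congr rfl fun x _ => ?_
    rw [hFB x, mul_add]
  -- the fluctuation energies `P_A = P_B = s − s²X/N ≥ 0`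
  have hPA : ∑ y, ∑ v, ∑ w, ft v y * B v w * ft w y = (s : ℝ) - (s : ℝ) ^ 2 / N * X := by
    have h := Fluct.fluctA_energy (G := G) s B (fun v w hB => ⟨(hc v w hB).1, (hc v w hB).2.2.1⟩) hdA
    rwa [htr, mul_one] at h
  have hPB : ∑ y, ∑ v, ∑ w, gt v y * B v w * gt w y = (s : ℝ) - (s : ℝ) ^ 2 / N * X := by
    have h := Fluct.fluctB_energy (G := G) s B (fun v w hB => ⟨(hc v w hB).2.1, (hc v w hB).2.2.2⟩) hdB
    rwa [htr, mul_one] at h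
  have hP0 : 0 ≤ (s : ℝ) - (s : ℝ) ^ 2 / N * X := by
    rw [← hPA]; exact Finset.sum_nonneg fun y _ => hpsd fun v => ft v y
  -- the centred test function and the convolution bound `Q ≤ M² P_B`
  have hθM : ∀ ψ : AddChar G ℂ, ‖∑ x, (θ x : ℂ) * ψ x‖ ≤ M := fun ψ => charsum_centred_le F M hM hFM ψ
  have hθconv : ∀ (w : Finset G × Finset G) (y : G), ∑ x, θ x * gt w (y - x) = H w y :=
    fun w y => conv_centred_eq F (gt w) (Rep.sum_fluct w.2) y
  have hQ : ∑ y, ∑ v, ∑ w, H v y * B v w * H w y ≤ M ^ 2 * ((s : ℝ) - (s : ℝ) ^ 2 / N * X) := by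
    have h := conv_energy_le' B gt θ M hpsd hθM
    simp_rw [hθconv] at h; rwa [hPB] at h
  -- Cauchy–Schwarz: S² ≤ P_A · Q ≤ (M P)², hence S ≥ −M P
  have hCS := cross_sq_le B hsymm hpsd ft H; rw [hPA] at hCS
  have hS : -(M * ((s : ℝ) - (s : ℝ) ^ 2 / N * X)) ≤ ∑ y, ∑ v, ∑ w, ft v y * B v w * H w y := by
    have h2 : (∑ y, ∑ v, ∑ w, ft v y * B v w * H w y) ^ 2 ≤
        (M * ((s : ℝ) - (s : ℝ) ^ 2 / N * X)) ^ 2 :=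
      calc (∑ y, ∑ v, ∑ w, ft v y * B v w * H w y) ^ 2
          ≤ ((s : ℝ) - (s : ℝ) ^ 2 / N * X) * ∑ y, ∑ v, ∑ w, H v y * B v w * H w y := hCS
        _ ≤ ((s : ℝ) - (s : ℝ) ^ 2 / N * X) * (M ^ 2 * ((s : ℝ) - (s : ℝ) ^ 2 / N * X)) :=
          mul_le_mul_of_nonneg_left hQ hP0
        _ = (M * ((s : ℝ) - (s : ℝ) ^ 2 / N * X)) ^ 2 := by ring
    exact (abs_le_of_sq_le_sq' h2 (mul_nonneg hM hP0)).1
  have e : (s : ℝ) ^ 2 / N * X = (s : ℝ) ^ 2 * X / N := by ring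
  rw [e] at hS; rw [hΦ]; linarith

end Bounds

/-! ### The registered stub -/

/-- **Registered stub `stub_thetaDegreeOne`** (crux stmt-MatrixMultiplication-14310, line
fixed-delta-theta-certificate): the degree-one (scalar Delsarte) certificate bound in the theta body.
`G` finite abelian, `s ≥ 1`, `X₀ ⊆ G`, a symmetric PSD entrywise-nonnegative trace-one kernel `B` on block
pairs supported on admissible × admissible pairs that are equal or compatible, a real test function `F` with
`F ≤ 1` on `X₀` and `F ≤ 0` off `X₀`, and `M ≥ 0` bounding its NONTRIVIAL character sums.  Then, with
`X = Σ_{v,w} B v w`, `s · X · (Σ_x F x) ≤ s · |G| + M · (|G| − s · X)`. -/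
theorem stub_thetaDegreeOne :
    ∀ (G : Type) [AddCommGroup G] [Fintype G] [DecidableEq G] (s : ℕ), 1 ≤ s →
      ∀ (X₀ : Finset G) (B : Finset G × Finset G → Finset G × Finset G → ℝ) (F : G → ℝ) (M : ℝ),
      (∀ v w, B v w = B w v) →
      (∀ x : Finset G × Finset G → ℝ, 0 ≤ ∑ v, ∑ w, x v * B v w * x w) →
      (∀ v w, 0 ≤ B v w) →
      (∀ v w : Finset G × Finset G, B v w ≠ 0 →
        (v.1.card = s ∧ v.2.card = s ∧
          (∀ a ∈ v.1, ∀ a' ∈ v.1, ∀ b ∈ v.2, ∀ b' ∈ v.2, (a - a') + (b - b') = 0 → a = a' ∧ b = b') ∧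
          v.1 - v.2 ⊆ X₀) ∧
        (w.1.card = s ∧ w.2.card = s ∧
          (∀ a ∈ w.1, ∀ a' ∈ w.1, ∀ b ∈ w.2, ∀ b' ∈ w.2, (a - a') + (b - b') = 0 → a = a' ∧ b = b') ∧
          w.1 - w.2 ⊆ X₀) ∧
        (v = w ∨ (Disjoint (v.1 - w.2) X₀ ∧ Disjoint (w.1 - v.2) X₀))) →
      ∑ v, B v v = 1 →
      0 ≤ M →
      (∀ x ∈ X₀, F x ≤ 1) →
      (∀ x, x ∉ X₀ → F x ≤ 0) →
      (∀ ψ : AddChar G ℂ, ψ ≠ 1 → ‖∑ x, (F x : ℂ) * ψ x‖ ≤ M) →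
      (s : ℝ) * (∑ v, ∑ w, B v w) * (∑ x, F x) ≤
        (s : ℝ) * (Fintype.card G : ℝ) + M * ((Fintype.card G : ℝ) - (s : ℝ) * ∑ v, ∑ w, B v w) := by
  intro G _ _ _ s hs X₀ B F M hsymm hpsd hnn hsupp htr hM hF1 hF0 hFM
  have hN : (0 : ℝ) < Fintype.card G := by exact_mod_cast Fintype.card_pos
  have hs' : (0 : ℝ) < s := by exact_mod_cast hs
  -- derived support facts
  have hcard : ∀ v : Finset G × Finset G, B v v ≠ 0 → v.1.card = s ∧ v.2.card = s :=
    fun v h => ⟨(hsupp v v h).1.1, (hsupp v v h).1.2.1⟩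
  have hD : ∀ v : Finset G × Finset G, B v v ≠ 0 → v.1 - v.2 ⊆ X₀ := fun v h => (hsupp v v h).1.2.2.2
  have hX : ∀ v w : Finset G × Finset G, B v w ≠ 0 → v ≠ w → Disjoint (v.1 - w.2) X₀ :=
    fun v w h hvw => ((hsupp v w h).2.2.resolve_left hvw).1
  have hc : ∀ v w : Finset G × Finset G, B v w ≠ 0 →
      v.1.card = s ∧ v.2.card = s ∧ w.1.card = s ∧ w.2.card = s :=
    fun v w h => ⟨(hsupp v w h).1.1, (hsupp v w h).1.2.1, (hsupp v w h).2.1.1, (hsupp v w h).2.1.2.1⟩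
  have hdA : ∀ v w : Finset G × Finset G, B v w ≠ 0 → v ≠ w → Disjoint v.1 w.1 := by
    intro v w h hvw
    obtain ⟨⟨_, hv2, _, hvD⟩, _, hcomp⟩ := hsupp v w h
    obtain ⟨b, hb⟩ : v.2.Nonempty := by rw [← Finset.card_pos, hv2]; exact hs
    exact Finset.disjoint_left.2 fun a hav haw => Finset.disjoint_left.1 (hcomp.resolve_left hvw).2
      (Finset.sub_mem_sub haw hb) (hvD (Finset.sub_mem_sub hav hb))
  have hdB : ∀ v w : Finset G × Finset G, B v w ≠ 0 → v ≠ w → Disjoint v.2 w.2 := by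
    intro v w h hvw
    obtain ⟨⟨hv1, _, _, hvD⟩, _, hcomp⟩ := hsupp v w h
    obtain ⟨a, ha⟩ : v.1.Nonempty := by rw [← Finset.card_pos, hv1]; exact hs
    exact Finset.disjoint_left.2 fun b hbv hbw => Finset.disjoint_left.1 (hcomp.resolve_left hvw).1
      (Finset.sub_mem_sub ha hbw) (hvD (Finset.sub_mem_sub ha hbv))
  -- the two bounds on Φ, and assembly (multiply by N / s)
  have key := le_trans (sum_F_mul_ge s B F M hsymm hpsd hc hdA hdB htr hM hFM)
    (sum_F_mul_le s X₀ B F hnn hcard hD hX htr hF1 hF0)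
  set N : ℝ := (Fintype.card G : ℝ)
  set X : ℝ := ∑ v, ∑ w, B v w
  set Fs : ℝ := ∑ x, F x
  set ρ : ℝ := (s : ℝ) ^ 2 * X / N
  have hρN : ρ * N = (s : ℝ) ^ 2 * X := div_mul_cancel₀ _ hN.ne'
  have k2 : N * (Fs * ρ - M * ((s : ℝ) - ρ)) ≤ N * (s : ℝ) ^ 2 := mul_le_mul_of_nonneg_left key hN.le
  have k3 : (s : ℝ) * ((s : ℝ) * X * Fs) ≤ (s : ℝ) * ((s : ℝ) * N + M * (N - (s : ℝ) * X)) := by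
    have e3 : (s : ℝ) * ((s : ℝ) * X * Fs) = ρ * N * Fs := by rw [hρN]; ring
    have e4 : (s : ℝ) * ((s : ℝ) * N + M * (N - (s : ℝ) * X)) =
        N * (s : ℝ) ^ 2 + M * (s : ℝ) * N - M * (ρ * N) := by rw [hρN]; ring
    rw [e3, e4]; linarith
  exact le_of_mul_le_mul_left k3 hs'

end Summit.MatrixMultiplication.MatrixMultiplication.Theorems.PrimeLogDecayTheta.DegreeOne
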